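import Literature.Probability.RandomPlanarGeometry.USTPeanoTreeLaw
import Literature.Probability.LatticeModels.MixedBoundaryHarmonic
import HarnessLib

/-!
# `P[A] = ĥ(v₀)`: the UST Peano path law and the mixed harmonic function ([LSW04] Thm. 4.4)

G. F. Lawler, O. Schramm, W. Werner, Ann. Probab. **32** (2004), proof of Theorem 4.4, p. 975:
"Let `A` be the event that the path in the tree `T(γ)` from `v₀` to `α` hits `A′₁`. […] By
Wilson's algorithm, `P[A]` is the probability that a simple random walk on the graph `H(∂D)`
started at `v₀` stopped on hitting `α` will cross `A′₁`. This is exactly `ĥ(v₀)`, where the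
function `ĥ` is as defined in Proposition 4.1."

Combining the transport of the UST Peano path law to the uniform spanning forest of `H(D)`
(`Domain.ustLaw_preimage_peanoForestEquiv`, `USTPeanoTreeLaw.lean`) with Wilson's algorithm and
the first-step analysis of the entrance probability (`Forest.ust_br_exists_endsWith_eq`,
`Forest.mixedLaplacian_hhat`, `MixedBoundaryHarmonic.lean`): for a set of "good" entrance edges
`x → r` into `α` (those crossing the arc `A′₁`), the `ustLaw D`-probability that the branch of
`T(γ)` from `v` enters `α` through a good edge is `ĥ(v)`, the `Δ_{H,E₀,E₁,E₂}`-harmonic function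
of [LSW04] §4.1 (`Domain.ustLaw_real_br_exists_endsWith_eq`); and the counting form for peeling
data (`PeelData.Good.card_isPath_br_exists_endsWith_eq`), to be used after conditioning on a
prefix (`USTPeanoPeelAlong.lean`, `USTPeanoBranchAlong.lean`).
-/

noncomputable section

open scoped ENNReal Classical
open MeasureTheory
open Literature.Probability.LatticeModels
open Literature.Probability.LatticeModels.StoppedWalk
open Literature.Probability.LatticeModels.LoopErasedWalkIdentity

namespace Literature.Probability.LatticeModels

open Literature.Probability.RandomPlanarGeometry

namespace Forest

variable {V : Type*} [Fintype V] [DecidableEq V] {H : SimpleGraph V} {R : Finset V}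

/-- The loop erasure keeps the entrance edge: the stopped-walk mass of "the loop erasure enters
through a good edge" is the entrance mass. [folklore] -/
theorem wsum_exists_endsWith_loopErase_eq (good : V → V → Prop) {v : V} (hv : v ∉ R) :
    wsum (srw H) v (fun t => IsStoppedAt (↑R : Set V) (v :: t) ∧
        ∃ x r, good x r ∧ EndsWith x r (v :: loopErase (afterLast v t))) =
      entryMass H R good v := by
  rw [entryMass]
  refine wsum_congr _ fun t => ?_
  constructor
  · rintro ⟨hst, x, r, hg, hE⟩
    refine ⟨hst, x, r, hg, (endsWith_loopErase_iff hv hst x r).1 ?_⟩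
    rwa [loopErase_cons]
  · rintro ⟨hst, x, r, hg, hE⟩
    refine ⟨hst, x, r, hg, ?_⟩
    rw [← loopErase_cons]
    exact (endsWith_loopErase_iff hv hst x r).2 hE

end Forest

end Literature.Probability.LatticeModels

namespace Literature.Probability.RandomPlanarGeometry

namespace USTPeano

namespace PeelData

variable {P₀ : Finset (ℤ × ℤ)} {S : PeelData}

/-- **`P[A] = ĥ(v)` for peeling data, counting form**: among the Peano paths of good data `S`,
those whose tree has its branch from `v ∉ roots` entering the roots through a good edge number
`#paths · ĥ(v)` (`ĥ` = the entrance probability of simple random walk on `H(S)` stopped at the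
roots). [cite: LawlerSchrammWerner2004, Theorem 4.4 (proof, p. 975)] -/
theorem Good.card_isPath_br_exists_endsWith_eq (h : S.Good) (hP : S.amb ⊆ P₀) {v : ↥P₀}
    (hv : v ∉ S.roots P₀) (good : ↥P₀ → ↥P₀ → Prop) :
    (Nat.card {γ : {l // S.IsPath l} //
        ∃ x r, good x r ∧ Forest.EndsWith x r (v :: (Good.pathForestEquiv S h hP γ).br v)} : ℝ≥0∞) =
      Nat.card {l // S.IsPath l} * Forest.entryMass (S.primalGraph P₀) (S.roots P₀) good v := by
  rw [h.card_isPath_br_pred_eq hP hv (fun L => ∃ x r, good x r ∧ Forest.EndsWith x r (v :: L)),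
    Forest.wsum_exists_endsWith_loopErase_eq good hv]

end PeelData

namespace Domain

variable (D : Domain)

/-- **`P[A] = ĥ(v₀)`** ([LSW04] proof of Thm. 4.4, p. 975): under the UST Peano path law of `D`,
the probability that the branch of the tree `T(γ)` from a vertex `v ∉ α` of `H(D)` enters `α`
through a good edge equals the entrance probability of simple random walk on `H(D)` from `v`
stopped on hitting `α`. [cite: LawlerSchrammWerner2004, Theorem 4.4 (proof, p. 975)] -/
theorem ustLaw_br_exists_endsWith_eq {v : ↥D.peelData.amb} (hv : v ∉ D.treeRoots)
    (good : ↥D.peelData.amb → ↥D.peelData.amb → Prop) :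
    ustLaw D {γ | ∃ x r, good x r ∧ Forest.EndsWith x r (v :: (D.peanoForestEquiv γ).br v)} =
      Forest.entryMass D.treeGraph D.treeRoots good v := by
  rw [← Forest.ust_br_exists_endsWith_eq D.reachesRoot_treeGraph hv, ← ustLaw_preimage_peanoForestEquiv]
  rfl

/-- **`P[A] = ĥ(v₀)`**, real-valued: the same probability is LSW's `Δ_{H,E₀,E₁,E₂}`-harmonic
function `ĥ` at `v` (`Forest.hhat`; harmonic by `Forest.mixedLaplacian_hhat`, unique by
`Forest.eq_hhat_of_mixedLaplacian_eq_zero`). [cite: LawlerSchrammWerner2004, Theorem 4.4 (proof, p. 975)] -/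
theorem ustLaw_real_br_exists_endsWith_eq {v : ↥D.peelData.amb} (hv : v ∉ D.treeRoots)
    (good : ↥D.peelData.amb → ↥D.peelData.amb → Prop) :
    (ustLaw D).real {γ | ∃ x r, good x r ∧ Forest.EndsWith x r (v :: (D.peanoForestEquiv γ).br v)} =
      Forest.hhat D.treeGraph D.treeRoots good v := by
  rw [measureReal_def, D.ustLaw_br_exists_endsWith_eq hv good, Forest.hhat]

end Domain

end USTPeano

end Literature.Probability.RandomPlanarGeometry
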